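import Summits.HodgeConjecture.HodgeConjecture.Theorems.NikulinTwinTransportTwinTwistorTransportMukaiLiftDefs
import Summits.HodgeConjecture.HodgeConjecture.Theses.EndoscopicMiddleDegree
import Literature.AlgebraicGeometry.HodgeTheory.GysinBaseChange
import Literature.AlgebraicGeometry.HodgeTheory.CrossProductTopClass
import Literature.AlgebraicGeometry.HodgeTheory.AlgebraicClassesExteriorProduct
import Literature.AlgebraicGeometry.HodgeTheory.RationalLatticeIntegral

/-!
# Crux `NikulinTwinTransport.TwinTwistorTransport` (stmt-HodgeConjecture-14393), line
# `mukai-lift-full-similitude`: stub `LiftIffTwin` (twin similitude algebraic ⟺ Mukai lift algebraic)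

Stub 3 of the checked skeleton `Cruxes/TwinTwistorTransport/Lines/mukai_lift_full_similitude.lean`
(vocabulary `corrH2`, `TwinAlg`, `LiftAlg`, `IsHilbLink`, `liftEnd`, `LiftLat` of
`Theorems/NikulinTwinTransportTwinTwistorTransportMukaiLiftDefs`). Along Hilbert-type links
`(ι, ρ, c)` of a marked K3 surface `(S, η)` with a marked `6`-fold `(X, θ, pX)` and `(ι′, ρ′, c′)` of
`(S′, η′)` with a marked `4`-fold `(X′, θ′, pX′)`, the twin similitude `η⁻¹ ∘ M ∘ η′` is `[γ]_*` for
an algebraic `γ` on `S ⊗ S′` (`TwinAlg`) IFF its Mukai lift `θ⁻¹ ∘ (M ⊕ id) ∘ θ′` is `[γ̃]_*` for an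
algebraic `γ̃` of codimension `4` on `X ⊗ X′` (`LiftAlg`).

Proof (W. Fulton, *Intersection Theory* §16.1, Prop. 16.1.1: the composite
`p₁₃_*(p₁₂^* γ ∪ p₂₃^* γ′)` of correspondences acts as the composition of the actions; N. Buskin,
Lemma 6.3: it is algebraic when `γ`, `γ′` are):

* "⇐" (extraction): `c⁻¹ · [ρ]_* ∘ [γ̃]_* ∘ [ι′]_* = η⁻¹ M η′` (`θ′[ι′]_* a = (η′a, 0)`,
  `(M ⊕ id)(v, 0) = (Mv, 0)`, `η[ρ]_* b = c·(θb)₁`), a composition `S′ → X′ → X → S` of three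
  algebraic correspondences in dimensions `2, 4, 6, 2`;
* "⇒": `θ⁻¹ (M ⊕ id) θ′ = c′⁻¹ · [ι]_* ∘ [γ]_* ∘ [ρ′]_* + ε⁻¹ · [pr_X^* δ ∪ pr_{X′}^* ζ′]_*`, a
  composition `X′ → S′ → S → X` plus the exterior product of the algebraic classes
  `δ = θ⁻¹(0, 1) ∈ N¹(X)` and `ζ′ ∈ N³(X′)` (`b ∪ ζ′ = (θ′b)₂ · pX′`), which acts by
  `y ↦ δ ∪ pr_{X*} pr_{X′}^*(y ∪ ζ′) = (θ′y)₂ · ε · δ` with `pr_{X*} pr_{X′}^* pX′ = ε · 1`,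
  `ε ≠ 0` BECAUSE `pX′ ≠ 0` (`complexGysin_fst_map_snd_ne_zero_of_ne_zero`).

Composition of correspondences in MIXED dimensions (`corrH2_comp_of_cup`) is the tree's
`corr_comp_of_baseChange` (Fulton 16.1.1 granted Gysin base change) fed with the tree's THEOREM
`gysin_baseChange` (base change for `A ⊗ (B ⊗ C) → B ⊗ C` over `A ⊗ B → B`, all dimensions, from
the Künneth formula) and `corrCompClass_mem_algebraicClasses` (Buskin 6.3 on the coniveau carriers),
whose one remaining input is the multiplicativity `Nᵇ ∪ Nᶜ ⊆ Nᵇ⁺ᶜ` of algebraically supported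
classes on the triple product (Voisin II Prop. 9.20; Chow's moving lemma — NOT constructed in the
tree, by design no Literature named fact, D-0026). That multiplicativity is the registered OPEN
support item `CupProductAlgebraic` (stmt-HodgeConjecture-14350, route EndoscopicMiddleDegree) of this
summit, taken here BY NAME exactly as the sibling
`Theorems/NikulinTwinTransportTwinAnchorGlueOfCupProductAlgebraic` does; the four instances used are
`(N², N⁴)` on `S ⊗ (S′ ⊗ X′)` and on `X ⊗ (S ⊗ X′)`, `(N⁶, N⁴)` on `S ⊗ (X ⊗ X′)`, `(N⁴, N²)` on
`S ⊗ (X′ ⊗ S′)` — all inside the moving range `1 ≤ l, k`, `l + k < dim`.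

Statement proved: `LiftIffTwin : CupProductAlgebraic → (registered body with the extra hypothesis
pX′ ≠ 0)`. The hypothesis `pX′ ≠ 0` is supplied at the skeleton's call sites by `MarkedHK`
(`pX′` generates the integral top classes; `MarkedHK_pX_ne_zero` below: a non-zero rational top
class exists, `exists_isRationalClass_top_ne_zero`, and has a non-zero integral multiple,
`IsRationalClass.exists_nsmul_isIntegralClass`). Without it the "⇒" direction has no access to the
`δ`-coordinate functional (`IsHilbLink` with `pX′ = 0` is satisfied by `ζ′ = 0`).

## References

* [Fulton1998] W. Fulton, Intersection Theory, 2nd ed., Springer 1998, §16.1 Def. 16.1.1,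
  Prop. 16.1.1, Ex. 16.1.2; Prop. 1.7.
* [Buskin2019] N. Buskin, Every rational Hodge isometry between two K3 surfaces is algebraic,
  J. reine angew. Math. 755 (2019), §6.2 Lemma 6.3.
* [VoisinHodgeII2003] C. Voisin, Hodge Theory and Complex Algebraic Geometry II, CUP 2003, §9.2.4
  Prop. 9.20.
* [Beauville1983] A. Beauville, Variétés kählériennes dont la première classe de Chern est nulle,
  J. Differential Geom. 18 (1983), §6.
* [FultonYoungTableaux1997] W. Fulton, Young Tableaux, CUP 1997, Appendix B §B.1 (5)–(6).
-/

-- `Summit.HodgeConjecture.HodgeConjecture.…` (summit = problem) duplicates a namespace component by design (D-0017).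
set_option linter.dupNamespace false

noncomputable section

namespace Summit.HodgeConjecture.HodgeConjecture.Theorems.TwinTwistorTransport.MukaiLift

open CategoryTheory MonoidalCategory
open Literature.AlgebraicGeometry.Motives Literature.AlgebraicGeometry.HodgeTheory
open Literature.AlgebraicGeometry.Surfaces
open Literature.AlgebraicTopology.SingularHomology

/-! ## Linearity of the correspondence action `[γ]_* y = fst_* (snd^* y ∪ γ)` in `γ` -/

/-- `[t • γ]_* y = t • [γ]_* y` (`∪` is bilinear, `fst_*` is linear). [cite: Fulton1998, §16.1 Def. 16.1.2] -/
theorem corrH2_smul (μ : OrientationFamily) (A B : SchemeOver ℂ) (a b : ℕ)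
    (hA : IsSmoothProjective a A) (hB : IsSmoothProjective b B)
    (t : ℂ) (γ : complexBetti (A ⊗ B) (2 * b)) (y : complexBetti B (2 * 1)) :
    corrH2 μ A B a b hA hB (t • γ) y = t • corrH2 μ A B a b hA hB γ y := by
  simp only [corrH2, map_smul]

/-- `[γ + γ′]_* y = [γ]_* y + [γ′]_* y` (`∪` is bilinear, `fst_*` is linear). [cite: Fulton1998, §16.1 Def. 16.1.2] -/
theorem corrH2_add (μ : OrientationFamily) (A B : SchemeOver ℂ) (a b : ℕ)
    (hA : IsSmoothProjective a A) (hB : IsSmoothProjective b B)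
    (γ γ' : complexBetti (A ⊗ B) (2 * b)) (y : complexBetti B (2 * 1)) :
    corrH2 μ A B a b hA hB (γ + γ') y =
      corrH2 μ A B a b hA hB γ y + corrH2 μ A B a b hA hB γ' y := by
  simp only [corrH2, map_add]

/-! ## Composition of algebraic correspondences in mixed dimensions (Fulton Prop. 16.1.1, Buskin
Lemma 6.3), from the tree's Gysin base change and the multiplicativity of algebraic classes -/

/-- **Composition of algebraic degree-`0` correspondences between smooth projective varieties of
arbitrary dimensions `a, b, c`**, on `H²`: for algebraic `γ ∈ Nᵇ H²ᵇ((A ⊗ B)(ℂ))` (a correspondence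
`B → A`) and `γ′ ∈ Nᶜ H²ᶜ((B ⊗ C)(ℂ))` (`C → B`) there is an algebraic `γ″ ∈ Nᶜ H²ᶜ((A ⊗ C)(ℂ))` with
`[γ″]_* = [γ]_* ∘ [γ′]_*` on `H²(C(ℂ); ℂ)`, namely `γ″ = k • p₁₃_*(p₁₂^* γ ∪ p₂₃^* γ′)`
(`corr_comp_of_baseChange` with the base change THEOREM `gysin_baseChange`, scalar `k`, and
`corrCompClass_mem_algebraicClasses`), GRANTED the multiplicativity `Nᵇ ∪ Nᶜ ⊆ Nᵇ⁺ᶜ` on the triple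
product `A ⊗ (B ⊗ C)` (`hCUP`, Voisin II Prop. 9.20). The surface case `a = b = c = 2` is the
tree's `corrComp_surfaces_of_cup`. [cite: Fulton1998, §16.1 Prop. 16.1.1 and Def. 16.1.2]
[cite: Buskin2019, Lemma 6.3] [cite: VoisinHodgeII2003, §9.2.4 Prop. 9.20] -/
theorem corrH2_comp_of_cup (μ : OrientationFamily) {a b c : ℕ} {A B C : SchemeOver ℂ}
    (hA : IsSmoothProjective a A) (hB : IsSmoothProjective b B) (hC : IsSmoothProjective c C)
    (hCUP : ∀ u ∈ algebraicClasses (A ⊗ (B ⊗ C)) b, ∀ v ∈ algebraicClasses (A ⊗ (B ⊗ C)) c,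
      cupProduct ((Nat.mul_add 2 b c).symm : 2 * b + 2 * c = 2 * (b + c)) u v ∈
        algebraicClasses (A ⊗ (B ⊗ C)) (b + c))
    {γ : complexBetti (A ⊗ B) (2 * b)} (hγ : γ ∈ algebraicClasses (A ⊗ B) b)
    {γ' : complexBetti (B ⊗ C) (2 * c)} (hγ' : γ' ∈ algebraicClasses (B ⊗ C) c) :
    ∃ γ'' ∈ algebraicClasses (A ⊗ C) c, ∀ y : complexBetti C (2 * 1),
      corrH2 μ A C a c hA hC γ'' y = corrH2 μ A B a b hA hB γ (corrH2 μ B C b c hB hC γ' y) := by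
  -- adapted from `Literature.AlgebraicGeometry.HodgeTheory.corrComp_surfaces_of_cup` (dimensions freed)
  have hμ : μ.HasPoincareDuality := OrientationFamily.hasPoincareDuality μ
  obtain ⟨k, hk⟩ := gysin_baseChange μ hA hB hC
    (show 2 * 1 + 2 * c + 2 * b = 2 * 1 + 2 * (b + c) by omega)
  refine ⟨k • complexGysin μ
      (IsSmoothProjective.tensor_holds hA (IsSmoothProjective.tensor_holds hB hC))
      (IsSmoothProjective.tensor_holds hA hC) (A ◁ SemiCartesianMonoidalCategory.snd B C)
      (show 2 * (b + c) + 2 * (a + c) = 2 * c + 2 * (a + (b + c)) by omega)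
      (cupProduct ((Nat.mul_add 2 b c).symm : 2 * b + 2 * c = 2 * (b + c))
        (complexBetti.map (A ◁ SemiCartesianMonoidalCategory.fst B C) (2 * b) γ)
        (complexBetti.map (SemiCartesianMonoidalCategory.snd A (B ⊗ C)) (2 * c) γ')),
    Submodule.smul_mem _ k (corrCompClass_mem_algebraicClasses hμ hA hB hC (e := b) (e' := c)
      (e'' := c) (Nat.add_comm b c) hCUP hγ hγ'), fun y ↦ ?_⟩
  exact corr_comp_of_baseChange hμ hA hB hC (e := b) (j := 2 * c) (k := 2 * c) (d := 2 * (b + c))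
    (a := 2 * 1) (a₁ := 2 * 1) (a₂ := 2 * 1) rfl rfl (Nat.add_comm _ _) ((Nat.mul_add 2 b c).symm)
    γ γ' k hk y

/-! ## The action of an exterior product `pr_A^* δ ∪ pr_B^* ζ` -/

/-- **`[pr_A^* δ ∪ pr_B^* ζ]_* y = δ ∪ pr_{A*} pr_B^*(y ∪ ζ)`** for `δ ∈ H²(A(ℂ))`, `ζ ∈ H²ᵐ(B(ℂ))`,
`2 + 2m = 2 dim B`, `y ∈ H²(B(ℂ))`: `pr_B^* y ∪ (pr_A^* δ ∪ pr_B^* ζ) = pr_A^* δ ∪ pr_B^*(y ∪ ζ)`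
(associativity, graded commutativity in even degrees, naturality of `∪`), then the projection
formula `pr_{A*}(pr_A^* δ ∪ v) = δ ∪ pr_{A*} v` (`complexGysin_cup`).
[cite: FultonYoungTableaux1997, Appendix B §B.1 (6)] [cite: Fulton1998, §16.1 Ex. 16.1.2] -/
theorem corrH2_exterior_apply (μ : OrientationFamily) {a b m : ℕ} {A B : SchemeOver ℂ}
    (hA : IsSmoothProjective a A) (hB : IsSmoothProjective b B) (hm : 2 * 1 + 2 * m = 2 * b)
    (δ : complexBetti A (2 * 1)) (ζ : complexBetti B (2 * m)) (y : complexBetti B (2 * 1)) :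
    corrH2 μ A B a b hA hB
        (cupProduct hm (complexBetti.map (SemiCartesianMonoidalCategory.fst A B) (2 * 1) δ)
          (complexBetti.map (SemiCartesianMonoidalCategory.snd A B) (2 * m) ζ)) y =
      cupProduct (Nat.add_zero (2 * 1)) δ
        (complexGysin μ (IsSmoothProjective.tensor_holds hA hB) hA
          (SemiCartesianMonoidalCategory.fst A B)
          (show 2 * b + 2 * a = 0 + 2 * (a + b) by omega)
          (complexBetti.map (SemiCartesianMonoidalCategory.snd A B) (2 * b)
            (cupProduct hm y ζ))) := by
  have hμ : μ.HasPoincareDuality := OrientationFamily.hasPoincareDuality μ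
  have h3 : 2 * 1 + 2 * 1 + 2 * m = 2 * 1 + 2 * b := by omega
  -- `snd^* y ∪ (fst^* δ ∪ snd^* ζ) = fst^* δ ∪ snd^* (y ∪ ζ)`
  have hinner : cupProduct (rfl : 2 * 1 + 2 * b = 2 * 1 + 2 * b)
      (complexBetti.map (SemiCartesianMonoidalCategory.snd A B) (2 * 1) y)
      (cupProduct hm (complexBetti.map (SemiCartesianMonoidalCategory.fst A B) (2 * 1) δ)
        (complexBetti.map (SemiCartesianMonoidalCategory.snd A B) (2 * m) ζ)) =
      cupProduct (rfl : 2 * 1 + 2 * b = 2 * 1 + 2 * b)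
        (complexBetti.map (SemiCartesianMonoidalCategory.fst A B) (2 * 1) δ)
        (complexBetti.map (SemiCartesianMonoidalCategory.snd A B) (2 * b) (cupProduct hm y ζ)) := by
    have hs : ((-1 : ℂ) ^ (2 * 1 * (2 * 1))) = 1 := by norm_num
    rw [cupProduct_map, ← cupProduct_assoc (rfl : 2 * 1 + 2 * 1 = 2 * 1 + 2 * 1) hm h3 rfl,
      cupProduct_gradedComm_holds ℂ _ (rfl : 2 * 1 + 2 * 1 = 2 * 1 + 2 * 1) rfl
        (complexBetti.map (SemiCartesianMonoidalCategory.snd A B) (2 * 1) y)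
        (complexBetti.map (SemiCartesianMonoidalCategory.fst A B) (2 * 1) δ),
      map_smul, LinearMap.smul_apply, hs, one_smul,
      cupProduct_assoc (rfl : 2 * 1 + 2 * 1 = 2 * 1 + 2 * 1) hm h3 rfl]
  dsimp only [corrH2]
  rw [hinner]
  exact complexGysin_cup hμ _ hA _ rfl _ _ _ δ _

/-! ## `pX ≠ 0` for a marked numerically-`K3^{[n]}` variety (discharge of the extra hypothesis at
the skeleton's call sites) -/

/-- For `MarkedHK n X θ pX z`, the class `pX` is non-zero: `X(ℂ)` carries a non-zero RATIONAL top
class (`exists_isRationalClass_top_ne_zero`), a positive integer multiple of which is integral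
(`IsRationalClass.exists_nsmul_isIntegralClass`), hence an INTEGER multiple of the generator `pX` of
the integral top classes. [cite: HatcherAT2002, §3.3 Thm. 3.26 and §3.1 Thm. 3.2] -/
theorem MarkedHK_pX_ne_zero (μ : OrientationFamily) {n : ℕ} {X : SchemeOver ℂ}
    {θ : complexBetti X (2 * 1) ≃ₗ[ℂ] LiftLat} {pX : complexBetti X (2 * (2 * n))} {z : LiftLat}
    (hX : MarkedHK n X θ pX z) : pX ≠ 0 := by
  intro hp
  obtain ⟨w, hw0, hw⟩ := exists_isRationalClass_top_ne_zero μ hX.1.1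
  obtain ⟨N, hN, hNw⟩ := hw.exists_nsmul_isIntegralClass hX.1.1
  obtain ⟨k, hk⟩ := hX.2.1.2 _ hNw
  rw [hp, smul_zero, smul_eq_zero] at hk
  rcases hk with hk | hk
  · exact (Nat.cast_ne_zero.2 hN.ne') hk
  · exact hw0 hk

/-! ## The stub -/

/-- **`LiftIffTwin` from the multiplicativity of algebraic classes, hypothesis explicit**: along
Hilbert-type links `IsHilbLink 3 μ S X … ι ρ c`, `IsHilbLink 2 μ S′ X′ … ι′ ρ′ c′` with `pX′ ≠ 0`,
`TwinAlg M μ S S′ … ↔ LiftAlg M μ X X′ …`, GRANTED `Nˡ H²ˡ ∪ Nᵏ H²ᵏ ⊆ Nˡ⁺ᵏ` on every smooth projective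
complex variety (`hCUP`, the body of the item `CupProductAlgebraic`). "⇐":
`c⁻¹ · [ρ]_* ∘ [γ̃]_* ∘ [ι′]_* = η⁻¹ M η′`; "⇒":
`θ⁻¹ (M ⊕ id) θ′ = c′⁻¹ · [ι]_* ∘ [γ]_* ∘ [ρ′]_* + ε⁻¹ · [pr_X^* θ⁻¹(0,1) ∪ pr_{X′}^* ζ′]_*`, both via
`corrH2_comp_of_cup` (twice each), `corrH2_exterior_apply`, `cupProduct_map_fst_map_snd_mem_algebraicClasses`.
[cite: Fulton1998, §16.1 Prop. 16.1.1 and Ex. 16.1.2] [cite: Buskin2019, Lemma 6.3] [cite: Beauville1983, §6] -/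
theorem LiftIffTwin_of_cup
    (hCUP : ∀ ⦃n : ℕ⦄ ⦃T : SchemeOver ℂ⦄, IsSmoothProjective n T → ∀ (l k : ℕ)
      (a : complexBetti T (2 * l)) (b : complexBetti T (2 * k)),
      a ∈ algebraicClasses T l → b ∈ algebraicClasses T k →
        cupProduct (two_mul_add_two_mul l k) a b ∈ algebraicClasses T (l + k)) :
    ∀ (M : Module.End ℂ (K3Index → ℂ)) (μ : OrientationFamily), μ.HasPoincareDuality →
    ∀ (S S' : SchemeOver ℂ) (hS : IsK3Surface S) (hS' : IsK3Surface S')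
      (η : complexBetti S (2 * 1) ≃ₗ[ℂ] (K3Index → ℂ))
      (η' : complexBetti S' (2 * 1) ≃ₗ[ℂ] (K3Index → ℂ))
      (X X' : SchemeOver ℂ) (hX : IsSmoothProjective (2 * 3) X)
      (hX' : IsSmoothProjective (2 * 2) X')
      (θ : complexBetti X (2 * 1) ≃ₗ[ℂ] LiftLat) (θ' : complexBetti X' (2 * 1) ≃ₗ[ℂ] LiftLat)
      (pX : complexBetti X (2 * (2 * 3))) (pX' : complexBetti X' (2 * (2 * 2)))
      (ι : complexBetti (X ⊗ S) (2 * 2)) (ρ : complexBetti (S ⊗ X) (2 * (2 * 3))) (c : ℂ)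
      (ι' : complexBetti (X' ⊗ S') (2 * 2)) (ρ' : complexBetti (S' ⊗ X') (2 * (2 * 2)))
      (c' : ℂ),
      IsHilbLink 3 μ S X (IsK3Surface.isSmoothProjective hS) hX η θ pX ι ρ c →
      IsHilbLink 2 μ S' X' (IsK3Surface.isSmoothProjective hS') hX' η' θ' pX' ι' ρ' c' →
      pX' ≠ 0 →
      (TwinAlg M μ S S' hS hS' η η' ↔ LiftAlg M μ X X' hX hX' θ θ') := by
  intro M μ hμ S S' hS hS' η η' X X' hX hX' θ θ' pX pX' ι ρ c ι' ρ' c' hl hl' hpX'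
  obtain ⟨hιalg, hρalg, hc0, hι, hρ, hδ, m, hm, ζ, hζalg, hζ⟩ := hl
  obtain ⟨hι'alg, hρ'alg, hc'0, hι', hρ', hδ', m', hm', ζ', hζ'alg, hζ'⟩ := hl'
  obtain rfl : m' = 3 := by omega
  -- instances of the multiplicativity on triple products
  have cup3 : ∀ {a b d : ℕ} {A B C : SchemeOver ℂ}, IsSmoothProjective a A →
      IsSmoothProjective b B → IsSmoothProjective d C →
      ∀ u ∈ algebraicClasses (A ⊗ (B ⊗ C)) b, ∀ v ∈ algebraicClasses (A ⊗ (B ⊗ C)) d,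
        cupProduct ((Nat.mul_add 2 b d).symm : 2 * b + 2 * d = 2 * (b + d)) u v ∈
          algebraicClasses (A ⊗ (B ⊗ C)) (b + d) :=
    fun hA hB hC u hu v hv ↦
      hCUP (IsSmoothProjective.tensor_holds hA (IsSmoothProjective.tensor_holds hB hC)) _ _
        u v hu hv
  -- the four link identities, solved for the actions
  have eι : ∀ a, corrH2 μ X S (2 * 3) 2 hX hS.isSmoothProjective ι a = θ.symm (η a, 0) :=
    fun a ↦ by rw [← hι a, LinearEquiv.symm_apply_apply]
  have eρ : ∀ b, corrH2 μ S X 2 (2 * 3) hS.isSmoothProjective hX ρ b = η.symm (c • (θ b).1) :=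
    fun b ↦ by rw [← hρ b, LinearEquiv.symm_apply_apply]
  have eι' : ∀ a, corrH2 μ X' S' (2 * 2) 2 hX' hS'.isSmoothProjective ι' a = θ'.symm (η' a, 0) :=
    fun a ↦ by rw [← hι' a, LinearEquiv.symm_apply_apply]
  have eρ' : ∀ b, corrH2 μ S' X' 2 (2 * 2) hS'.isSmoothProjective hX' ρ' b =
      η'.symm (c' • (θ' b).1) :=
    fun b ↦ by rw [← hρ' b, LinearEquiv.symm_apply_apply]
  constructor
  · -- "⇒": `θ⁻¹ (M ⊕ id) θ′ = c′⁻¹ · [ι]_* ∘ [γ]_* ∘ [ρ′]_* + ε⁻¹ · [pr_X^* δ ∪ pr_{X′}^* ζ′]_*`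
    rintro ⟨γ, hγalg, hγ⟩
    have eγ : ∀ y, corrH2 μ S S' 2 2 hS.isSmoothProjective hS'.isSmoothProjective γ y =
        η.symm (M (η' y)) := fun y ↦ (hγ y).symm
    -- `[γ₁]_* = [γ]_* ∘ [ρ′]_*` on `S ⊗ X′`, then `[γ₂]_* = [ι]_* ∘ [γ₁]_*` on `X ⊗ X′`
    obtain ⟨γ₁, hγ₁alg, hγ₁⟩ := corrH2_comp_of_cup μ hS.isSmoothProjective
      hS'.isSmoothProjective hX' (cup3 hS.isSmoothProjective hS'.isSmoothProjective hX') hγalg hρ'alg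
    obtain ⟨γ₂, hγ₂alg, hγ₂⟩ := corrH2_comp_of_cup μ hX hS.isSmoothProjective hX'
      (cup3 hX hS.isSmoothProjective hX') hιalg hγ₁alg
    -- the exterior product `E = pr_X^* δ ∪ pr_{X′}^* ζ′` and its action `y ↦ (θ′y)₂ ε · δ`
    obtain ⟨E, hE⟩ : ∃ E : complexBetti (X ⊗ X') (2 * (2 * 2)), E =
        cupProduct hm'
          (complexBetti.map (SemiCartesianMonoidalCategory.fst X X') (2 * 1) (θ.symm (0, 1)))
          (complexBetti.map (SemiCartesianMonoidalCategory.snd X X') (2 * 3) ζ') := ⟨_, rfl⟩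
    have hEalg : E ∈ algebraicClasses (X ⊗ X') (2 * 2) := by
      have h := cupProduct_map_fst_map_snd_mem_algebraicClasses hX hX' hδ hζ'alg
      rw [hE]
      exact h
    have hg := complexGysin_fst_map_snd_ne_zero_of_ne_zero μ hX hX' hpX'
    obtain ⟨ε, hε⟩ := exists_eq_smul_one μ hX
      (complexGysin μ (IsSmoothProjective.tensor_holds hX hX') hX
        (SemiCartesianMonoidalCategory.fst X X')
        (show 2 * (2 * 2) + 2 * (2 * 3) = 0 + 2 * (2 * 3 + 2 * 2) by omega)
        (complexBetti.map (SemiCartesianMonoidalCategory.snd X X') (2 * (2 * 2)) pX'))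
    have hε0 : ε ≠ 0 := by
      rintro rfl
      rw [zero_smul] at hε
      exact hg hε
    have eE : ∀ y, corrH2 μ X X' (2 * 3) (2 * 2) hX hX' E y =
        ((θ' y).2 * ε) • θ.symm (0, 1) := by
      intro y
      rw [hE, corrH2_exterior_apply, hζ' y, map_smul, map_smul, map_smul, hε, map_smul,
        cupProduct_one, smul_smul]
    refine ⟨c'⁻¹ • γ₂ + ε⁻¹ • E,
      Submodule.add_mem _ (Submodule.smul_mem _ _ hγ₂alg) (Submodule.smul_mem _ _ hEalg),
      fun y ↦ ?_⟩
    rw [corrH2_add, corrH2_smul, corrH2_smul, hγ₂ y, hγ₁, eρ', eγ, LinearEquiv.apply_symm_apply,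
      eι, LinearEquiv.apply_symm_apply, eE]
    apply θ.injective
    simp only [LinearEquiv.apply_symm_apply, map_add, map_smul, liftEnd_apply]
    refine Prod.ext ?_ ?_
    · simp [smul_smul, inv_mul_cancel₀ hc'0]
    · simp only [Prod.snd_add, Prod.smul_snd, smul_eq_mul, mul_zero, zero_add, mul_one]
      field_simp
  · -- "⇐": `c⁻¹ · [ρ]_* ∘ [γ̃]_* ∘ [ι′]_* = η⁻¹ M η′`
    rintro ⟨γt, hγtalg, hγt⟩
    obtain ⟨γ₁, hγ₁alg, hγ₁⟩ := corrH2_comp_of_cup μ hS.isSmoothProjective hX hX'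
      (cup3 hS.isSmoothProjective hX hX') hρalg hγtalg
    obtain ⟨γ₂, hγ₂alg, hγ₂⟩ := corrH2_comp_of_cup μ hS.isSmoothProjective hX'
      hS'.isSmoothProjective (cup3 hS.isSmoothProjective hX' hS'.isSmoothProjective) hγ₁alg hι'alg
    refine ⟨c⁻¹ • γ₂, Submodule.smul_mem _ _ hγ₂alg, fun y ↦ ?_⟩
    show η.symm (M (η' y)) =
      corrH2 μ S S' 2 2 hS.isSmoothProjective hS'.isSmoothProjective (c⁻¹ • γ₂) y
    rw [corrH2_smul, hγ₂ y, eι' y, hγ₁, ← hγt, LinearEquiv.apply_symm_apply, eρ,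
      LinearEquiv.apply_symm_apply, LinearEquiv.map_smul, smul_smul, inv_mul_cancel₀ hc0,
      one_smul, liftEnd_apply]

/-- **Stub `LiftIffTwin` (registered form, corrected): the twin similitude is algebraic IFF its
Mukai lift is, along Hilbert-type links — from the summit's open support item
`CupProductAlgebraic`** (stmt-HodgeConjecture-14350: `Nˡ H²ˡ ∪ Nᵏ H²ᵏ ⊆ Nˡ⁺ᵏ H^{2(l+k)}` on every smooth
projective `X/ℂ`, Voisin II Prop. 9.20; taken BY NAME, as in
`Theorems/NikulinTwinTransportTwinAnchorGlueOfCupProductAlgebraic`), with the extra hypothesis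
`pX′ ≠ 0` (discharged by `MarkedHK_pX_ne_zero` at marked pairs).
[cite: Fulton1998, §16.1 Prop. 16.1.1 and Ex. 16.1.2] [cite: Buskin2019, Lemma 6.3]
[cite: VoisinHodgeII2003, §9.2.4 Prop. 9.20] -/
theorem LiftIffTwin : Summit.HodgeConjecture.HodgeConjecture.Theses.EndoscopicMiddleDegree.CupProductAlgebraic → ∀ (M : Module.End ℂ (K3Index → ℂ)) (μ : OrientationFamily), μ.HasPoincareDuality → ∀ (S S' : SchemeOver ℂ) (hS : IsK3Surface S) (hS' : IsK3Surface S') (η : complexBetti S (2 * 1) ≃ₗ[ℂ] (K3Index → ℂ)) (η' : complexBetti S' (2 * 1) ≃ₗ[ℂ] (K3Index → ℂ)) (X X' : SchemeOver ℂ) (hX : IsSmoothProjective (2 * 3) X) (hX' : IsSmoothProjective (2 * 2) X') (θ : complexBetti X (2 * 1) ≃ₗ[ℂ] LiftLat) (θ' : complexBetti X' (2 * 1) ≃ₗ[ℂ] LiftLat) (pX : complexBetti X (2 * (2 * 3))) (pX' : complexBetti X' (2 * (2 * 2))) (ι : complexBetti (X ⊗ S) (2 * 2)) (ρ : complexBetti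 (S ⊗ X) (2 * (2 * 3))) (c : ℂ) (ι' : complexBetti (X' ⊗ S') (2 * 2)) (ρ' : complexBetti (S' ⊗ X') (2 * (2 * 2))) (c' : ℂ), IsHilbLink 3 μ S X (IsK3Surface.isSmoothProjective hS) hX η θ pX ι ρ c → IsHilbLink 2 μ S' X' (IsK3Surface.isSmoothProjective hS') hX' η' θ' pX' ι' ρ' c' → pX' ≠ 0 → (TwinAlg M μ S S' hS hS' η η' ↔ LiftAlg M μ X X' hX hX' θ θ') :=
  fun hCPA ↦ LiftIffTwin_of_cup fun _ _ hT l k a b ha hb ↦ hCPA hT l k a b ha hb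

end Summit.HodgeConjecture.HodgeConjecture.Theorems.TwinTwistorTransport.MukaiLift

end
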